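import Summits.AnomalousDissipation.AnomalousDissipation.Theorems.SawtoothPulseCascadeK1LocalisedCascadeLedgerRecursion

/-!
# K1loc, line `Spectral` / thin start — helper: the high off-cone channel inside a ratio class of the ledger

Helper file of the prover lane on the crux `K1LocalisedCascade` (stmt-AnomalousDissipation-19491), route
`SawtoothPulseCascade` (S-D fibre ledger; memo v13 §15).  The target `hch` counts the high off-cone channel
`Σ'[K ≤ |k₀| ∧ 13/10·|k₀| < γ|k₁|]‖𝓕a_n‖²` (real inequalities on the integer frequencies); the ledger bounds ratio classes
`Σ'[X ≤ |k₀| ∧ u|k₀| ≤ v|k₁|]‖𝓕a_n‖²` (integers, `…RatioClassStepV`).  This file is the inclusion between them: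
* `offCone_indicator_le_ratioClass` — if `X ≤ K` and `10γ·u ≤ 13v` then
  `[K ≤ |k₀| ∧ 13/10·|k₀| < γ|k₁|] ≤ [X ≤ |k₀| ∧ u|k₀| ≤ v|k₁|]` (e.g. `γ = 8`, `u = 6`, `v = 40`);
* `tsum_offCone_le_ratioClass` — the same for indicator-weighted nonnegative summable densities;
* `tsum_target_le_strip_add_ratioClass` — `LowBand(L) + HighOffCone(L) ≤ S(K) + O′(X)` for `L ≤ K`, `X ≤ K`.
Together with `…LedgerRecursion.tsum_lowBand_offCone_le` this turns the ledger's `S_n(K_n) + O′_n(K_n)` into a bound for the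
target's `LowBand_n + HighOffCone_n`.  No definitions; no statement about the crux. [cite: Grafakos2014, Prop. 3.2.7 (3)] [problem: turb]
-/

-- `Summit.<Summit>.<Problem>`: single-conjunct summit, the duplicate namespace segment is deliberate.
set_option linter.dupNamespace false

noncomputable section

namespace Summit.AnomalousDissipation.AnomalousDissipation.Theorems.SawtoothPulseCascade.K1Window

/-- **Off-cone ⊆ ratio class**: for `X ≤ K` and `10γu ≤ 13v` (`u ≥ 0`),
`[K ≤ |k₀| ∧ 13/10·|k₀| < γ|k₁|] ≤ [X ≤ |k₀| ∧ u|k₀| ≤ v|k₁|]`. [folklore] -/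
theorem offCone_indicator_le_ratioClass {γ : ℝ} {u v : ℕ} (huv : 10 * γ * u ≤ 13 * v) {X K : ℤ} (hXK : X ≤ K)
    (k₀ k₁ : ℤ) :
    (if (K : ℝ) ≤ |(k₀ : ℝ)| ∧ 13 / 10 * |(k₀ : ℝ)| < γ * |(k₁ : ℝ)| then (1 : ℝ) else 0) ≤
      (if X ≤ |k₀| ∧ (u : ℤ) * |k₀| ≤ v * |k₁| then (1 : ℝ) else 0) := by
  by_cases h : (K : ℝ) ≤ |(k₀ : ℝ)| ∧ 13 / 10 * |(k₀ : ℝ)| < γ * |(k₁ : ℝ)|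
  · rw [if_pos h]
    have h1 : X ≤ |k₀| := by
      have : (K : ℝ) ≤ ((|k₀| : ℤ) : ℝ) := by rw [Int.cast_abs]; exact h.1
      exact hXK.trans (by exact_mod_cast this)
    have h2 : (u : ℤ) * |k₀| ≤ v * |k₁| := by
      have hu : (0 : ℝ) ≤ u := Nat.cast_nonneg _
      have ha : (0 : ℝ) ≤ |(k₀ : ℝ)| := abs_nonneg _
      -- `13·u|k₀| ≤ 10γu|k₁|·… `: from `13/10|k₀| < γ|k₁|` and `10γu ≤ 13v`
      have h3 : 13 * ((u : ℝ) * |(k₀ : ℝ)|) ≤ 13 * ((v : ℝ) * |(k₁ : ℝ)|) := by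
        have hb : (0 : ℝ) ≤ |(k₁ : ℝ)| := abs_nonneg _
        have h4 : (u : ℝ) * (13 * |(k₀ : ℝ)|) ≤ (u : ℝ) * (10 * γ * |(k₁ : ℝ)|) :=
          mul_le_mul_of_nonneg_left (by linarith [h.2]) hu
        have h5 : 10 * γ * (u : ℝ) * |(k₁ : ℝ)| ≤ 13 * (v : ℝ) * |(k₁ : ℝ)| := mul_le_mul_of_nonneg_right huv hb
        nlinarith
      have h6 : (u : ℝ) * |(k₀ : ℝ)| ≤ (v : ℝ) * |(k₁ : ℝ)| := by linarith
      have h7 : (((u : ℤ) * |k₀| : ℤ) : ℝ) ≤ (((v : ℤ) * |k₁| : ℤ) : ℝ) := by push_cast; exact h6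
      exact_mod_cast h7
    rw [if_pos ⟨h1, h2⟩]
  · rw [if_neg h]; split_ifs <;> norm_num

/-- **High off-cone channel ≤ ratio class** for indicator-weighted nonnegative summable densities. [folklore] -/
theorem tsum_offCone_le_ratioClass {ι : Type*} {c : ι → ℝ} (hc : Summable c) (hc0 : ∀ k, 0 ≤ c k) (k₀ k₁ : ι → ℤ)
    {γ : ℝ} {u v : ℕ} (huv : 10 * γ * u ≤ 13 * v) {X K : ℤ} (hXK : X ≤ K) :
    ∑' k, (if (K : ℝ) ≤ |((k₀ k : ℤ) : ℝ)| ∧ 13 / 10 * |((k₀ k : ℤ) : ℝ)| < γ * |((k₁ k : ℤ) : ℝ)| then (1 : ℝ) else 0) * c k ≤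
      ∑' k, (if X ≤ |k₀ k| ∧ (u : ℤ) * |k₀ k| ≤ v * |k₁ k| then (1 : ℝ) else 0) * c k := by
  have hI : ∀ (p : ι → Prop) [DecidablePred p], Summable fun k => (if p k then (1 : ℝ) else 0) * c k := by
    intro p _
    refine Summable.of_nonneg_of_le (fun k => mul_nonneg (by split_ifs <;> norm_num) (hc0 k)) (fun k => ?_) hc
    exact mul_le_of_le_one_left (hc0 k) (by split_ifs <;> norm_num)
  exact (hI _).tsum_le_tsum (fun k => mul_le_mul_of_nonneg_right (offCone_indicator_le_ratioClass huv hXK _ _) (hc0 k)) (hI _)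

/-- **The target channels inside the ledger classes**: for a nonnegative summable density `c` on `ℤ²`-indexed frequencies
(`c k = ‖𝓕a_n(k)‖²`), a real low-band threshold `L ≤ K` (`K : ℕ`, e.g. `K = K_n ≥ (1+1/250)c(γ²−3)ⁿ`), `X ≤ K` and `10γu ≤ 13v`:
`Σ'[|k₀| < L]c + Σ'[L ≤ |k₀| ∧ 13/10·|k₀| < γ|k₁|]c ≤ Σ'[|k₀| < K]c + Σ'[X ≤ |k₀| ∧ u|k₀| ≤ v|k₁|]c` — the low band and the high
off-cone channel of `hch` are dominated by the strip `S_n(K)` and the off-cone ratio class `O′_n(X)` of the ledger. [folklore] -/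
theorem tsum_target_le_strip_add_ratioClass {ι : Type*} {c : ι → ℝ} (hc : Summable c) (hc0 : ∀ k, 0 ≤ c k)
    (k₀ k₁ : ι → ℤ) {γ L : ℝ} {u v K : ℕ} {X : ℤ} (huv : 10 * γ * u ≤ 13 * v) (hLK : L ≤ K) (hXK : X ≤ K) :
    ∑' k, (if |((k₀ k : ℤ) : ℝ)| < L then (1 : ℝ) else 0) * c k +
        ∑' k, (if L ≤ |((k₀ k : ℤ) : ℝ)| ∧ 13 / 10 * |((k₀ k : ℤ) : ℝ)| < γ * |((k₁ k : ℤ) : ℝ)| then (1 : ℝ) else 0) * c k ≤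
      ∑' k, (if |k₀ k| < (K : ℤ) then (1 : ℝ) else 0) * c k +
        ∑' k, (if X ≤ |k₀ k| ∧ (u : ℤ) * |k₀ k| ≤ v * |k₁ k| then (1 : ℝ) else 0) * c k := by
  have h1 := tsum_lowBand_offCone_le hc hc0 (fun k => ((k₀ k : ℤ) : ℝ))
    (fun k => 13 / 10 * |((k₀ k : ℤ) : ℝ)| < γ * |((k₁ k : ℤ) : ℝ)|) (K := (K : ℝ)) hLK
  refine h1.trans (add_le_add (le_of_eq (tsum_congr fun k => ?_)) ?_)
  · have : (|((k₀ k : ℤ) : ℝ)| < (K : ℝ)) ↔ (|k₀ k| < (K : ℤ)) := by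
      rw [← Int.cast_abs]; exact_mod_cast Iff.rfl
    simp only [this]
  · have h2 := tsum_offCone_le_ratioClass hc hc0 k₀ k₁ huv (K := (K : ℤ)) hXK
    have e : ∀ k, ((((K : ℕ) : ℤ) : ℝ) ≤ |((k₀ k : ℤ) : ℝ)|) ↔ ((K : ℝ) ≤ |((k₀ k : ℤ) : ℝ)|) := fun k => by norm_cast
    simp only [e] at h2
    exact h2

end Summit.AnomalousDissipation.AnomalousDissipation.Theorems.SawtoothPulseCascade.K1Window
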